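import Mathlib.Data.Nat.Bitwise
import Mathlib.Data.Finsupp.Basic
import Mathlib.Data.ZMod.Defs
import Mathlib.Data.Matrix.Basic
import Literature.NumberTheory.Transcendental.Associators
import Literature.NumberTheory.Transcendental.MultipleZetaStuffle
import HarnessLib

/-!
# The linearised extended double shuffle system, reduced mod 2: a kernel-checkable rank engine

Ihara–Kaneko–Zagier's *extended double shuffle* (EDS) relations [IharaKanekoZagier2006, §1–§2,
Conjecture 1] are LINEAR relations among the coefficients `c_w(φ)` (`w` a binary word of weight
`k`) of any series `φ` satisfying the regularised double shuffle relations — in this tree, of any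
group-like solution of Drinfeld's pentagon equation over a commutative `ℚ`-algebra (Furusho's
theorem, `NCSeries.DrinfeldPentagon.piY_mul_piY_eq_sum_stuffle` [Furusho2011, Thm 1.2]):

* for `s` admissible and `t` with positive entries, `wt s + wt t = k`, the *finite double shuffle*
  row `Σ_{u ∈ s ∗ t} (-1)^{|u|} c_{bw u} − (-1)^{|s|+|t|} Σ_{w ∈ bw s ш bw t} c_w = 0`
  (both sides equal `π_Y(φ)(s) π_Y(φ)(t)`);
* the words met that begin with the letter `y = X₁` ("divergent"; for the names used here they
  have exactly one leading `y`) are folded away by the regularisation identity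
  `c_{y x u} = − Σ_{v ∈ y ш u} c_{x v}` (group-likeness and `c_y = 0`).

The conjecture of IKZ (op. cit., Conjecture 1; verified by rank computations to weight 20 by
Kaneko–Noro–Tsurumaki 2008) is that these rows generate ALL linear relations, i.e. have corank
`d_k` (`Σ d_k t^k = 1/(1 - t² - t³)`) with the Hoffman words (`{2,3}`-indices) free. The present
file makes the statement "the EDS rows named in a list `names` have full rank MODULO 2 on the
non-Hoffman admissible words of weight `k`" DECIDABLE BY THE KERNEL in a few seconds up to weight
13: sets of words of a fixed length are packed into natural numbers (bit `code w`), the shuffle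
and harmonic products are computed directly on these bitsets (`shBits`, `stBits`, multiplicities
mod 2), the divergent words are folded (`foldDiv`), and a forward Gauss elimination over `𝔽₂`
(`elimLoop`, on the matrix packed into ONE natural number, a few GMP operations per column) looks
for a pivot in every column. `check k names`
is the Boolean verdict; its soundness (full rank mod 2 ⇒ the integer relation matrix has odd
determinant ⇒ every `c_w`, `w` of weight `k`, is a FIXED rational combination of Hoffman
coefficients at every pentagon solution) is proved in the sibling `LinEDS*` files from the
semantic definitions of §5 (`rowZ`, `divFold`, `evalZ`, `entry`).

Design: every function is structurally recursive (no well-founded recursion, no arrays), so that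
`decide +kernel` evaluates it; all heavy data are `Nat` literals handled by the kernel's GMP
arithmetic (`xor`, `land`, `lor`, `shiftLeft/Right`, `pow`, `mod`). Conventions: `false = x = X₀`,
`true = y = X₁` (as in `MZV.binaryWord`); the code of a word has its FIRST letter as the MOST
significant bit; a set of words of length `L` is a number `< 2^(2^L)`.

References: K. Ihara, M. Kaneko, D. Zagier, Compos. Math. 142 (2006) 307–338, §1–2
[IharaKanekoZagier2006]; H. Furusho, Ann. of Math. 174 (2011), Thm 1.2 [Furusho2011];
M. Kaneko, M. Noro, K. Tsurumaki, *On a conjecture for the dimension of the space of the multiple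
zeta values*, Software for Algebraic Geometry, IMA Vol. 148 (2008) 47–58 (rank of the EDS matrix
modulo a prime); M. E. Hoffman, J. Algebra 194 (1997) [Hoffman1997].
-/

namespace Literature.NumberTheory.Transcendental

namespace LinEDS

/-! ### §1 Words as numbers, sets of words as bitsets -/

/-- The code of a binary word: letters `x = false ↦ 0`, `y = true ↦ 1`, first letter most
significant (`code [x,y,y] = 3`). Words of length `L` correspond bijectively to `[0, 2^L)`.
[folklore] -/
def code : List Bool → ℕ
  | [] => 0
  | b :: w => b.toNat * 2 ^ w.length + code w

/-- The code of `MZV.binaryWord s` computed on the index `s`: prepending the block `x^{a-1} y` to a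
word of length `m` adds `2^m` (the new `y`; the `x`'s are leading zeros). [folklore] -/
def icode : List ℕ → ℕ
  | [] => 0
  | _ :: s => 2 ^ s.sum + icode s

/-- Prepend the letter `b` to every word of a set `S` of words of length `m` (as a bitset over
codes): `y` shifts all codes by `2^m`, `x` changes nothing. [folklore] -/
def pre (b : Bool) (m S : ℕ) : ℕ := bif b then S <<< (2 ^ m) else S

/-- Inner recursion of the bitset shuffle product (pattern of `MZV.shuffleWordAux`):
`shAux a u shU v` is the set, with multiplicities mod 2, of the words of `(a u) ш v`, given
`shU v' =` that of `u ш v'`. [folklore] -/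
def shAux (a : Bool) (u : List Bool) (shU : List Bool → ℕ) : List Bool → ℕ
  | [] => 2 ^ code (a :: u)
  | b :: v => pre a (u.length + v.length + 1) (shU (b :: v)) ^^^
      pre b (u.length + v.length + 1) (shAux a u shU v)

/-- **The shuffle product mod 2 as a bitset**: bit `code w` of `shBits u v` is the parity of the
multiplicity of `w` in `u ш v` (`MZV.shuffleWord u v`), by the recursion
`(a u) ш (b v) = a (u ш b v) + b (a u ш v)`. [folklore] -/
def shBits : List Bool → List Bool → ℕ
  | [], v => 2 ^ code v
  | a :: u, v => shAux a u (shBits u) v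

/-- Inner recursion of the bitset harmonic product (Hoffman's rule (A3)
`as ∗ bt = a(s ∗ bt) + b(as ∗ t) + (a+b)(s ∗ t)`), words coded through `icode`; prepending an
index letter to indices of weight `m` shifts codes by `2^m`. [cite: Hoffman1997, §2 (A1)–(A3)] -/
def stAux (a : ℕ) (s : List ℕ) (stS : List ℕ → ℕ) : List ℕ → ℕ
  | [] => 2 ^ icode (a :: s)
  | b :: t => ((stS (b :: t)) <<< (2 ^ (s.sum + (b + t.sum)))) ^^^
      (((stAux a s stS t) <<< (2 ^ (a + s.sum + t.sum))) ^^^ ((stS t) <<< (2 ^ (s.sum + t.sum))))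

/-- **The harmonic (stuffle) product mod 2 as a bitset**: bit `icode u` of `stBits s t` is the
parity of the multiplicity of `u` in `s ∗ t` (`MZV.stuffle s t`). [cite: Hoffman1997, §2] -/
def stBits : List ℕ → List ℕ → ℕ
  | [], t => 2 ^ icode t
  | a :: s, t => stAux a s (stBits s) t

/-! ### §2 Folding the divergent words -/

/-- Insert the letter `y` into the word (number) `u` above its `j` lowest letters. [folklore] -/
def insY (u j : ℕ) : ℕ := (((u >>> j) <<< (j + 1)) ||| 2 ^ j) ||| (u % 2 ^ j)

/-- XOR into `acc` the words obtained from `u` by inserting `y` above its `j` lowest letters for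
`j = 0, …, m` (the `m+1` insertions of `y ш u` for `u` of length `m`, mod 2). [folklore] -/
def insAll (u : ℕ) : ℕ → ℕ → ℕ
  | 0, acc => acc ^^^ 2 ^ insY u 0
  | j + 1, acc => insAll u j (acc ^^^ 2 ^ insY u (j + 1))

/-- Divide-and-conquer scan of a set `hi` of words (bit `i` of `hi` = the word with code
`base + i`, window of width `2^d`), XOR-ing into `acc` the `m+1` insertions of `y` into each word
met: this folds the divergent words `y x u ↦ Σ_{v ∈ y ш u} x v` (mod 2) once `hi` lists the `u`'s.
Only nonempty windows are visited. [folklore] -/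
def divScan (m : ℕ) : ℕ → ℕ → ℕ → ℕ → ℕ
  | 0, base, hi, acc => bif hi == 0 then acc else insAll base m acc
  | d + 1, base, hi, acc => bif hi == 0 then acc else
      divScan m d base (hi % 2 ^ 2 ^ d) (divScan m d (base + 2 ^ d) (hi >>> (2 ^ d)) acc)

/-- **Fold of the divergent words in weight `k`**: a set `R` of words of length `k` ending in `y`
whose divergent members have exactly one leading `y` (codes `2^(k-1) + u`, `u < 2^(k-2)` the word
after `y x`) is replaced by its convergent part XOR the insertion sets of the `u`'s — the mod-2
shadow of the regularisation `c_{y x u} = -Σ_{v ∈ y ш u} c_{x v}`. [cite: IharaKanekoZagier2006, §2] -/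
def foldDiv (k R : ℕ) : ℕ :=
  divScan (k - 2) (k - 2) 0 ((R >>> (2 ^ (k - 1))) % 2 ^ 2 ^ (k - 2)) (R % 2 ^ 2 ^ (k - 1))

/-! ### §3 Hoffman words and the columns -/

/-- The Hoffman indices (entries in `{2,3}`) of weight `n`, listed. [cite: Hoffman1997, §1] -/
def hofLists : ℕ → List (List ℕ)
  | 0 => [[]]
  | 1 => []
  | 2 => [[2]]
  | n + 3 => (hofLists (n + 1)).map (List.cons 2) ++ (hofLists n).map (List.cons 3)

/-- The set of codes of the Hoffman words of weight `k`. [cite: Hoffman1997, §1] -/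
def hofMask (k : ℕ) : ℕ := (hofLists k).foldr (fun t m => m ||| 2 ^ icode t) 0

/-- **The columns**: the codes of the admissible (first letter `x`, last letter `y`), non-Hoffman
words of weight `k`, i.e. the odd numbers below `2^(k-1)` outside `hofMask k`, increasing; there
are `2^(k-2) - d_k` of them. [cite: IharaKanekoZagier2006, §1] -/
def cols (k : ℕ) : List ℕ :=
  ((List.range (2 ^ (k - 2))).map fun i => 2 * i + 1).filter fun c => !(hofMask k).testBit c

/-- The set of column codes as a bitset (tail-recursive fold: the kernel's recursion depth stays
bounded however many columns there are). [folklore] -/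
def colMask (k : ℕ) : ℕ := (cols k).foldl (fun m c => m ||| 2 ^ c) 0

/-! ### §4 Row names, rows, elimination, the check -/

/-- A row name `(s, t)` is VALID in weight `k`: `s` nonempty admissible, `t` nonempty with positive
entries and not beginning `1, 1` (so that no word with two leading `y`'s occurs), total weight `k`.
[cite: IharaKanekoZagier2006, §2] -/
def validName (k : ℕ) (ν : List ℕ × List ℕ) : Bool :=
  match ν with
  | (a :: s, b :: t) => (2 ≤ a) && s.all (1 ≤ ·) && (1 ≤ b) && t.all (1 ≤ ·) &&
      !(b == 1 && t.head? == some 1) && ((a :: s).sum + (b :: t).sum == k)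
  | _ => false

/-- The raw row of a name mod 2: harmonic product XOR shuffle product (the signs of the integer
row `Σ_{u ∈ s∗t} (-1)^{|u|} e_{bw u} − (-1)^{|s|+|t|} Σ_{w ∈ bw s ш bw t} e_w` disappear mod 2).
[cite: IharaKanekoZagier2006, §2] -/
def rawBits (ν : List ℕ × List ℕ) : ℕ :=
  stBits ν.1 ν.2 ^^^ shBits (MZV.binaryWord ν.1) (MZV.binaryWord ν.2)

/-- **The row of a name** in weight `k`, mod 2, on the columns: fold the divergent words, keep the
column bits (the Hoffman words are the free unknowns and are dropped). [cite: IharaKanekoZagier2006, §2] -/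
def rowBits (k : ℕ) (ν : List ℕ × List ℕ) : ℕ := foldDiv k (rawBits ν) &&& colMask k

/-! The elimination works on the whole matrix PACKED into one number: row `i` (a bitset `< 2^W`,
`W = 2^(k-1)`) occupies the slot of bits `[iW, (i+1)W)`. One column step is then a handful of GMP
operations: with `p` the bottom slot and `sel = (M >>> c) &&& rep` the indicator (at the slot
bases) of the rows having bit `c`, the product `sel * p` places a copy of `p` in exactly those slots
(no carries: `p < 2^W`), so `M ^^^ (sel * p)` XORs the pivot into every row having bit `c`
(including the pivot row, which becomes zero) and `>>> W` drops the emptied bottom slot. The rows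
must therefore be LISTED IN PIVOT ORDER (row `j` is the pivot of the `j`-th column after reduction
by the previous ones) — the certificate's business; a wrong order only makes the check fail. -/

/-- One packing pass: merge adjacent pairs of blocks of width `w` (`[a, b, c, d, e] ↦
[a ||| b <<< w, c ||| d <<< w, e]`). [folklore] -/
def packPass (w : ℕ) : List ℕ → List ℕ
  | a :: b :: l => (a ||| (b <<< w)) :: packPass w l
  | l => l

/-- Repeated packing passes, doubling the block width, until one block is left (`f` = fuel).
Balanced merging allocates `O(log n)` copies of the matrix instead of `O(n)`. [folklore] -/
def packLoop : ℕ → ℕ → List ℕ → ℕ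
  | 0, _, l => l.headD 0
  | f + 1, w, l =>
    match l with
    | [] => 0
    | [a] => a
    | a :: b :: l' => packLoop f (2 * w) (packPass w (a :: b :: l'))

/-- Length, tail-recursively. [folklore] -/
def lengthTR {α : Type*} (l : List α) : ℕ := l.foldl (fun n _ => n + 1) 0

/-- Pack the rows into one number, row `i` in the slot `[iW, (i+1)W)` (first row lowest).
[folklore] -/
def pack (W : ℕ) (rows : List ℕ) : ℕ := packLoop (lengthTR rows) W rows

/-- `Σ_{i<n} 2^(iW)`: a `1` at the base of each of `n` slots. [folklore] -/
def rep (W n : ℕ) : ℕ := pack W (List.replicate n 1)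

/-- The two lists have the same length (tail-recursive). [folklore] -/
def sameLength {α β : Type*} : List α → List β → Bool
  | [], [] => true
  | _ :: l, _ :: l' => sameLength l l'
  | _, _ => false



/-- `p` has bit `c` and no lower bit. [folklore] -/
def isPivotAt (p c : ℕ) : Bool := p % 2 ^ (c + 1) == 2 ^ c

/-- **Forward Gauss elimination over `𝔽₂`, packed**: along the column list, the bottom slot `p`
must be a pivot for the current column `c` (bit `c`, nothing below); then `p` is XORed into every
row having bit `c` (`sel * p`, `sel = (M >>> c) &&& R` with `R = rep W n`) and the bottom slot is
dropped. Every slot of every intermediate matrix is an XOR-combination of the input rows.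
[folklore] -/
def elimLoop (W R : ℕ) : List ℕ → ℕ → Bool
  | [], _ => true
  | c :: cs, M =>
    let p := M % 2 ^ W
    isPivotAt p c && elimLoop W R cs ((M ^^^ (((M >>> c) &&& R) * p)) >>> W)

/-- **The check**: exactly as many names as columns, every name valid, and the packed forward
elimination of their rows (in the listed order) finds a pivot in every column — i.e. the named EDS
rows have full rank mod 2 on the non-Hoffman admissible words of weight `k`. Decidable by
`decide +kernel` in seconds (weight 13: `2032` columns; the work is GMP arithmetic on the packed
matrix). [cite: IharaKanekoZagier2006, Conjecture 1] -/
def check (k : ℕ) (names : List (List ℕ × List ℕ)) : Bool :=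
  sameLength names (cols k) && names.all (validName k) &&
    elimLoop (2 ^ (k - 1)) (rep (2 ^ (k - 1)) (lengthTR names)) (cols k)
      (pack (2 ^ (k - 1)) (names.map (rowBits k)))

/-! ### §5 Semantics: the integer rows and their evaluation at a series -/

/-- `Σ_{w ∈ L} e_w ∈ ℤ⟨x,y⟩` for a list of words with multiplicity. [folklore] -/
noncomputable def wordSumZ (L : List (List Bool)) : List Bool →₀ ℤ :=
  (L.map fun w => Finsupp.single w (1 : ℤ)).sum

/-- **The integer EDS row of a name** `(s,t)`:
`Σ_{u ∈ s ∗ t} (-1)^{|u|} e_{bw u} − (-1)^{|s|+|t|} Σ_{w ∈ bw s ш bw t} e_w`; at a group-like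
pentagon solution `φ` both halves evaluate to `π_Y(φ)(s) π_Y(φ)(t)`, so the row evaluates to `0`.
[cite: IharaKanekoZagier2006, §2] -/
noncomputable def rowZ (ν : List ℕ × List ℕ) : List Bool →₀ ℤ :=
  ((MZV.stuffle ν.1 ν.2).map fun u =>
      Finsupp.single (MZV.binaryWord u) ((-1 : ℤ) ^ u.length)).sum -
    (-1 : ℤ) ^ (ν.1.length + ν.2.length) •
      wordSumZ (MZV.shuffleWord (MZV.binaryWord ν.1) (MZV.binaryWord ν.2))

/-- The fold of one word: `y x u ↦ −Σ_{v ∈ y ш u} e_{x v}` (the regularisation identity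
`c_{y x u}(φ) = −Σ_{v ∈ y ш u} c_{x v}(φ)` of a group-like `φ` with `c_y(φ) = 0`); every other
word is kept. [cite: IharaKanekoZagier2006, §2] -/
noncomputable def divFoldWord : List Bool → (List Bool →₀ ℤ)
  | true :: false :: u => -wordSumZ ((MZV.shuffleWord [true] u).map (List.cons false))
  | w => Finsupp.single w 1

/-- The fold extended additively to `ℤ⟨x,y⟩`. [folklore] -/
noncomputable def divFold (f : List Bool →₀ ℤ) : List Bool →₀ ℤ :=
  f.sum fun w n => n • divFoldWord w

/-- Evaluation of `f ∈ ℤ⟨x,y⟩` at a series: `Σ_w f(w) · c_w(φ)`. [folklore] -/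
noncomputable def evalZ {R : Type*} [Ring R] (φ : NCSeries Bool R) (f : List Bool →₀ ℤ) : R :=
  f.sum fun w n => n • φ w

/-- The word of length `k` with a given code (most significant letter first). [folklore] -/
def wordOfCode (k c : ℕ) : List Bool := ((List.range k).map fun i => c.testBit i).reverse

/-- **The integer relation matrix**: entry of the folded row of the name `ν` at the column code
`c` in weight `k`. The engine's contract (sibling files): for a valid name and a column `c`,
bit `c` of `rowBits k ν` is the parity of `entry k ν c`. [cite: IharaKanekoZagier2006, §2] -/
noncomputable def entry (k : ℕ) (ν : List ℕ × List ℕ) (c : ℕ) : ℤ :=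
  divFold (rowZ ν) (wordOfCode k c)

/-! ### §6 Proof-side vocabulary (used by the soundness files) -/

/-- Slot `i` (width `W`) of a packed matrix. [folklore] -/
def slot (W M i : ℕ) : ℕ := (M >>> (i * W)) % 2 ^ W

/-- The XOR-combinations of a list of rows: the `𝔽₂`-span, on bitsets. [folklore] -/
inductive XorGen (rows : List ℕ) : ℕ → Prop
  | zero : XorGen rows 0
  | xor {a r : ℕ} : XorGen rows a → r ∈ rows → XorGen rows (a ^^^ r)

/-- The `𝔽₂`-vector of a bitset on a list of columns: coordinate `j` is bit `cs[j]`. [folklore] -/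
def vecOf (cs : List ℕ) (x : ℕ) : Fin cs.length → ZMod 2 :=
  fun j => if x.testBit (cs.get j) then 1 else 0

/-- **The integer relation matrix of a certificate**: rows = the names, columns = `cols k`,
entries = `entry`. The soundness files show: `check k names = true` ⇒ its determinant is odd.
[cite: IharaKanekoZagier2006, §2] -/
noncomputable def intMat (k : ℕ) (names : List (List ℕ × List ℕ)) :
    Matrix (Fin names.length) (Fin (cols k).length) ℤ :=
  fun i j => entry k (names.get i) ((cols k).get j)

/-! ### §7 Sanity values (computed by the kernel) -/

/-- `code [x,y,y] = 3`, `icode (2,1) = code (binaryWord (2,1))`, the weight-5 columns are the codes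
of `(5), (4,1), (2,2,1)… ` minus the Hoffman `(2,3), (3,2)`: `d₅ = 2`, `2^3 - 2 = 6` columns.
[folklore] -/
theorem sanity : code [false, true, true] = 3 ∧ icode [2, 1] = code (MZV.binaryWord [2, 1]) ∧
    (cols 5).length = 6 ∧ (hofLists 5).length = 2 ∧ (cols 8).length = 60 := by decide +kernel

/-- The smallest instance of the check: in weight `3` the single row `F((2),(1))`
(`ζ(2,1) = ζ(3)`) has full rank on the single non-Hoffman column `(2,1)`. [cite: IharaKanekoZagier2006, §2] -/
theorem check_three : check 3 [([2], [1])] = true := by decide +kernel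

/-! ### §8 Compact certificates: names as numerals -/

/-- Read an index off the binary expansion of `c` below its leading (sentinel) bit, from the low
end: a `1` closes the block being counted, a `0` lengthens it (`f` = fuel). [folklore] -/
def decomp : ℕ → ℕ → ℕ → List ℕ → List ℕ
  | 0, _, _, acc => acc
  | f + 1, c, cur, acc =>
    bif Nat.ble c 1 then (bif cur == 0 then acc else cur :: acc) else
      bif c % 2 == 1 then decomp f (c / 2) 1 (bif cur == 0 then acc else cur :: acc)
      else decomp f (c / 2) (cur + 1) acc

/-- The index `s` encoded by `2^(weight s) + code (binaryWord s)` (sentinel bit, then the word):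
`decodeIdx 11 = (2,1)` (`11 = 0b1011`, word `xyy`). [folklore] -/
def decodeIdx (c : ℕ) : List ℕ := decomp 64 c 0 []

/-- A row name `(s, t)` encoded by one numeral `enc s · 2^16 + enc t`. [folklore] -/
def decodeName (N : ℕ) : List ℕ × List ℕ := (decodeIdx (N / 2 ^ 16), decodeIdx (N % 2 ^ 16))

/-- **The check on an encoded certificate** (one numeral per row name; keeps the per-weight data
files short): `checkEnc k codes = check k (codes.map decodeName)`. [cite: IharaKanekoZagier2006, Conjecture 1] -/
def checkEnc (k : ℕ) (codes : List ℕ) : Bool := check k (codes.map decodeName)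

/-- `decodeName` on the encodings of `((2),(1))` and `((2,1),(3))`; the weight-3 check again, encoded.
[folklore] -/
theorem decodeName_examples : decodeName (5 * 2 ^ 16 + 3) = ([2], [1]) ∧
    decodeName (11 * 2 ^ 16 + 9) = ([2, 1], [3]) ∧ checkEnc 3 [5 * 2 ^ 16 + 3] = true := by
  decide +kernel

/-! ### §9 Block certificates: block lower-triangular by depth

For larger weights one kernel run over all `2^(k-2) - d_k` columns outgrows the memory budget
(`k = 14`: `4075` columns). The rows `F(s,t)` are supported on words of depth (number of `y`'s)
`≤ depth s + depth t` and the fold preserves the depth, so ordering the columns by depth makes the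
mod-2 matrix BLOCK LOWER TRIANGULAR once every row is assigned to a block of depths containing
all its columns: full rank mod 2 then follows block by block (`det = Π det(blocks)` mod 2), each
block being one small kernel run. A block is a range of depths `(lo, D]`; its rows must have no
bit at a column of depth `> D` and, masked to the block's columns, must eliminate fully. -/

/-- The number of `y`'s (set bits) among the `w` lowest letters of the code `c`: the depth of
the word. [folklore] -/
def popc : ℕ → ℕ → ℕ
  | 0, _ => 0
  | w + 1, c => c % 2 + popc w (c / 2)

/-- The columns of weight `k` whose depth lies in `(lo, hi]`, increasing. [cite: IharaKanekoZagier2006, §1] -/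
def colsDepth (k lo hi : ℕ) : List ℕ :=
  (cols k).filter fun c => Nat.blt lo (popc k c) && Nat.ble (popc k c) hi

/-- The bitset of a list of codes (tail-recursive). [folklore] -/
def maskOf (L : List ℕ) : ℕ := L.foldl (fun m c => m ||| 2 ^ c) 0

/-- **One block of a block certificate**: columns of depth in `(lo, D]`; exactly as many valid
names as block columns; no row has a bit at a column of depth `> D` (block triangularity); and
the rows masked to the block, packed in the listed (pivot) order, eliminate fully.
[cite: IharaKanekoZagier2006, Conjecture 1] -/
def checkBlock (k lo D : ℕ) (names : List (List ℕ × List ℕ)) : Bool :=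
  let C := colsDepth k lo D
  let mask := maskOf C
  let higher := maskOf (colsDepth k D k)
  let rows := names.map (rowBits k)
  sameLength names C && names.all (validName k) && rows.all (fun r => r &&& higher == 0) &&
    elimLoop (2 ^ (k - 1)) (rep (2 ^ (k - 1)) (lengthTR names)) C
      (pack (2 ^ (k - 1)) (rows.map (· &&& mask)))

/-- **One block, encoded names** (one numeral per row name, `decodeName`). [cite: IharaKanekoZagier2006, Conjecture 1] -/
def checkBlockEnc (k lo D : ℕ) (codes : List ℕ) : Bool := checkBlock k lo D (codes.map decodeName)

/-- Every column of weight `k` has depth at most `D` (the coverage condition closing a chain of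
blocks `(0, D₁], (D₁, D₂], …, (D_{B-1}, D]`). [folklore] -/
def depthCovered (k D : ℕ) : Bool := (cols k).all fun c => Nat.ble (popc k c) D

/-- Sanity: in weight `5` the depths of the `6` columns, and a two-block certificate
`(0,2] = {(5),(4,1),(3,2)?…}`: block `(0,1]` is the single column `(5)` with the row `F((4),(1))`…
— here only the elementary values are recorded: `popc`, `colsDepth`, `depthCovered`. [folklore] -/
theorem block_sanity : popc 5 0b01011 = 3 ∧ (colsDepth 5 0 1).length = 1 ∧
    (colsDepth 5 1 4).length = 5 ∧ depthCovered 5 4 = true ∧ depthCovered 5 3 = false := by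
  decide +kernel

end LinEDS

end Literature.NumberTheory.Transcendental
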